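import Mathlib

/-!
# Stub ideas k1 · gen 17 for `stub_heegnerIndexLowerAtTwo` — technique «weaken / strengthen»

Typed helper lemmas for the idea card `stub-heegnerindexloweratwo-k1-g17`
(crux `PrintCf2.SplitBadTwoLowerHalfOfFacts`, item `stmt-BirchSwinnertonDyer-27851`).

Scope: STUB-PLAN v3.7's ORDER-NOW item **R121″** (one in-range unit test of the
two-variable unit `u(d)`; «match the m-shift») and the **(a-val)** anchor step.
Nothing here proves BSD, the crux, the stub, S2′, ρ3 or R121″ itself: these are the
self-contained arithmetic / bookkeeping lemmas the three plans of the card lean on.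

* H1 `weightTwo_column`, `raising_column`, `factorial_columns_match` — PLAN 1 (strongest
  provable form of the absolute column): the Katz Γ-column `(k₁-1)!(k₂-1)! = m!(m-1)!` of the
  two factors of types `(1+m,-m)`, `(m,1-m)` equals the Shimura–Maass raising column
  `∏_{i<m-1} (2+i)(i+1) = (m-1)!·m!` of a weight-2 start raised `m-1` times (LZZ's `C_ι(m)`).
* H2 `eventuallyConst_kills_linear_and_log` (+ the `padicValNat` examples) — PLAN 2
  (strongest form of the m = 2^t oracle, B24): eventual constancy of `a + b·2^t + c·t`
  forces `b = 0 ∧ c = 0`, so neither a weight-linear nor a Legendre/log digit survives.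
* H3 `two_anchor_solve`, `value_all_keys`, `anchor_transfer` — PLAN 3 (weakest sufficient
  input for (a-val)): two decided anchors with 2-conductor exponents 2 and 3 pin the
  absolute residue `a₀` and R130's slope `b`; every other key's value / floor is then an
  explicit affine expression in the local tables.
* H4 `scaling_unit`, `scaling_cancels` — hygiene: LZZ Remark 1.7's rescaling
  `( , )_π ↦ c( , )_π` moves `𝓛 ↦ c⁻¹𝓛`, `u ↦ c·u`, and cancels in Thm 1.8.
-/

namespace Summit.BirchSwinnertonDyer.BirchSwinnertonDyer.Cruxes.SplitBadTwoLowerHalfOfFacts.StubIdeasK1G17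

/-! ## H1 — the factorial columns match (PLAN 1) -/

/-- Raising a holomorphic weight-2 vector `r` times: the norm column
`∏_{i<r} (2+i)(i+1)` is `r! · (r+1)!`. -/
theorem weightTwo_column (r : ℕ) :
    ∏ i ∈ Finset.range r, ((2 + i) * (i + 1)) = Nat.factorial r * Nat.factorial (r + 1) := by
  induction r with
  | zero => simp
  | succ r ih =>
    rw [Finset.prod_range_succ, ih, Nat.factorial_succ (r + 1), Nat.factorial_succ r]
    ring

/-- General lowest weight `k`: the column is `r! · k(k+1)⋯(k+r-1) = r! · k.ascFactorial r`. -/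
theorem raising_column (k r : ℕ) :
    ∏ i ∈ Finset.range r, ((k + i) * (i + 1)) = Nat.factorial r * k.ascFactorial r := by
  induction r with
  | zero => simp
  | succ r ih =>
    rw [Finset.prod_range_succ, ih, Nat.factorial_succ r, Nat.ascFactorial_succ]
    ring

/-- The m-shift matched: for `m ≥ 1` the Katz Γ-column of the two factors of types
`(1+m, -m)` and `(m, 1-m)` — namely `((1+m)-1)! · (m-1)!` — equals the Shimura–Maass
column of `m-1` raisings of a weight-2 start. -/
theorem factorial_columns_match (m : ℕ) (hm : 1 ≤ m) :
    Nat.factorial ((1 + m) - 1) * Nat.factorial (m - 1)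
      = ∏ i ∈ Finset.range (m - 1), ((2 + i) * (i + 1)) := by
  obtain ⟨r, rfl⟩ : ∃ r, m = r + 1 := ⟨m - 1, by omega⟩
  rw [weightTwo_column]
  simp [mul_comm]

/-! ## H2 — the oracle with logarithms (PLAN 2) -/

/-- If `a + b·2^t + c·t` is eventually constant then `b = 0` and `c = 0`:
neither a weight-linear digit (`Ω^{±k}`, `(ζ⁺ζ⁻)^k`, `(1/4i)^{2(k-1)}`, …) nor a
Legendre/logarithmic digit (`v₂((2^t)!) = 2^t - 1`, `v₂(2^t) = t`) survives the
`m = 2^t`-oracle; only the eventually-constant part does. -/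
theorem eventuallyConst_kills_linear_and_log (a b c L : ℤ) (t₀ : ℕ)
    (h : ∀ t : ℕ, t₀ ≤ t → a + b * 2 ^ t + c * t = L) : b = 0 ∧ c = 0 := by
  have h0 := h t₀ le_rfl
  have h1 := h (t₀ + 1) (by omega)
  have h2 := h (t₀ + 2) (by omega)
  push_cast at h0 h1 h2
  have hbX : b * 2 ^ t₀ = 0 := by linear_combination (h2 - h1) - (h1 - h0)
  have hX : (2 : ℤ) ^ t₀ ≠ 0 := by positivity
  have hb : b = 0 := by
    rcases mul_eq_zero.mp hbX with hb | hX0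
    · exact hb
    · exact absurd hX0 hX
  refine ⟨hb, ?_⟩
  linear_combination (h1 - h0) - hbX

/-- The log digit: `v₂(2^t) = t` (source of the `c·t` term above). -/
example (t : ℕ) : padicValNat 2 (2 ^ t) = t := by
  simp

/-- A Legendre digit instance: `v₂(8!) = 7 = 8 - 1` (the `b·2^t + c` shape with `b = 1`). -/
example : 2 ^ 7 ∣ Nat.factorial 8 ∧ ¬ 2 ^ 8 ∣ Nat.factorial 8 := by decide

/-! ## H3 — inter-key anchor transfer (PLAN 3) -/

/-- Two decided anchors with 2-conductor exponents `2` and `3` pin the absolute residue `a₀`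
and the currency slope `b` of `e_A(key) = a₀ + b·n(key) + Λ(key)` (R130 / R92‴ shape). -/
theorem two_anchor_solve (a₀ b β₂ β₃ : ℤ) (h2 : a₀ + 2 * b = β₂) (h3 : a₀ + 3 * b = β₃) :
    b = β₃ - β₂ ∧ a₀ = 3 * β₂ - 2 * β₃ := by
  constructor
  · linear_combination h3 - h2
  · linear_combination 3 * h2 - 2 * h3

/-- With the two anchors decided (`E₂`, `E₃` = the measured values at anchor keys `k₂`, `k₃`
with `n k₂ = 2`, `n k₃ = 3`), the value at EVERY key is an explicit affine expression in the
local table `Λ` and the exponent `n`: no further anchor is needed to KNOW it. -/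
theorem value_all_keys {Key : Type*} (n Λ : Key → ℤ) (a₀ b E₂ E₃ : ℤ) (k₂ k₃ : Key)
    (hn2 : n k₂ = 2) (hn3 : n k₃ = 3)
    (hA2 : a₀ + b * n k₂ + Λ k₂ = E₂) (hA3 : a₀ + b * n k₃ + Λ k₃ = E₃) (k : Key) :
    a₀ + b * n k + Λ k
      = (3 * (E₂ - Λ k₂) - 2 * (E₃ - Λ k₃)) + ((E₃ - Λ k₃) - (E₂ - Λ k₂)) * n k + Λ k := by
  rw [hn2] at hA2
  rw [hn3] at hA3
  linear_combination (3 - n k) * hA2 + (n k - 2) * hA3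

/-- One-sided version: an anchor inequality `β k₀ ≤ a₀` in the key with the LARGEST
threshold `β` transfers the floor `I` to every key with `β k ≤ β k₀`. -/
theorem anchor_transfer {Key : Type*} (β : Key → ℤ) (a₀ : ℤ) (I : Key → Prop)
    (hI : ∀ k, β k ≤ a₀ → I k) (k₀ : Key) (hanchor : β k₀ ≤ a₀)
    (k : Key) (hk : β k ≤ β k₀) : I k :=
  hI k (hk.trans hanchor)

/-! ## H4 — scaling hygiene (LZZ Remark 1.7) -/

/-- `( , )_π ↦ c·( , )_π` gives `𝓛 ↦ c⁻¹·𝓛`, hence the unit `u = K/𝓛 ↦ c·u`. -/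
theorem scaling_unit {F : Type*} [Field F] (K L c : F) (hc : c ≠ 0) (hL : L ≠ 0) :
    K / (c⁻¹ * L) = c * (K / L) := by
  field_simp

/-- … and in Thm 1.8 (`log·log = 𝓛(χ) · (toric ratio) · α♮`) the same `c` cancels
(`α♮ ↦ c·α♮`), so ONE global choice of `( , )_π` (e.g. `( , )_A`, Néron) fixes the
currency of `u(d)` for every member `d` at once. -/
theorem scaling_cancels {F : Type*} [Field F] (L R α c : F) (hc : c ≠ 0) :
    (c⁻¹ * L) * R * (c * α) = L * R * α := by
  field_simp

end Summit.BirchSwinnertonDyer.BirchSwinnertonDyer.Cruxes.SplitBadTwoLowerHalfOfFacts.StubIdeasK1G17
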